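import Literature.Topology.FourManifolds.MMSWRasmussenFacts
import Literature.Topology.FourManifolds.SliceDiscExteriorMeridian
import Summits.SmoothPoincare4.SmoothPoincare4.Theses.DottedCircleRasmussen
import Summits.SmoothPoincare4.SmoothPoincare4.Theorems.DottedCircleRasmussenDcrGapHelperFriendsPi1G2Aux

/-!
# Helper `helper_friendsPi1_G2` (sub-goal of stub `stub_friendsPi1`, line `mk_friends`, skeleton v3) for crux `DcrGap`
(item stmt-SmoothPoincare4-16128, route route-SmoothPoincare4-DottedCircleRasmussen)

**Kervaire's lemma for the model disc exterior.**  Let `D_k = MMSW.modelHandlebody k ⊂ ℝ⁴`, let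
`Δ₁ = f₁(𝔻²)` be a model slice disc of a model knot `K₁ ⊂ ∂D_k` with a trivialised tube
`T : D̊² × B(0,2) → ℝ⁴ ∖ D_k` of its interior (`T(x,0) = f₁ x`), and `E = ℝ⁴ ∖ (D_k ∪ Δ₁)` the model
disc exterior (an `Opens ℝ⁴`).  If `ℝ⁴ ∖ D_k` is simply connected (sub-goal G1, a hypothesis here), then
every continuous `ψ : E → Z` that kills the tube meridian `μ(v) = T(0, v/2)` (i.e. `ψ ∘ μ : S¹ → Z` is
freely null-homotopic) kills every loop of `E`: `π₁(E)` is the normal closure of the meridian.  This is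
Kervaire, Bull. SMF 93 (1965), Ch. I Lemme 1.2, in the form of Manolescu–Piccirillo (2023) §3.2
("`π₁(V)` is normally generated by the meridian"), ported from the tree's `k = 0` template
`SliceDiscExteriorMeridian.lean` (`ConicalDiscTube.homotopic_refl_map_of_meridian`) to the ambient
`ℝ⁴ ∖ D_k` in place of the convex open ball:

* `FriendsPi1G2.homotopic_refl_map_of_homotopic_const` — a map homotopic to a constant kills every
  loop (track formula `Path.Homotopic.map_trans_evalAt`); turns the free null-homotopy of `ψ ∘ μ` into
  the based one the van Kampen argument consumes;
* `FriendsPi1G2.fromPath_mem_zpowers_of_tube` — **loops inside the tube are powers of the meridian**: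
  a loop of a space `V` over `ℝ⁴` (think `V = E`) lying in `T(dom)` off the zero section pulls back
  through `T` to a loop of `D̊² × (B(0,2) ∖ 0) ≅ D̊² × (ℂ ∖ 0)`, whose `π₁` is generated by the slice
  winding loop (`PuncturedPlane.fromPath_mem_zpowers_slice`);
* `helper_friendsPi1_G2` — the registered statement: Seifert–van Kampen in kernel form
  (`VanKampen.fromPath_mem_of_homotopic_refl`, Hatcher Thm. 1.20) for the cover
  `ℝ⁴ ∖ D_k = E ∪ T(dom)`, `E ∩ T(dom) = T(D̊² × (B(0,2) ∖ 0))` (point-set facts: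
  `DottedCircleRasmussenDcrGapHelperFriendsPi1G2Aux.lean`) with `N = ker ψ_*`, realised inside the type
  `{x // x ∉ D_k}`, plus change of base point.

No definitions, no named facts, no `sorry`.

## References

* M. Kervaire, *Les nœuds de dimensions supérieures*, Bull. SMF 93 (1965), Ch. I Lemme 1.2. [KervaireBSMF1965]
* C. Manolescu, L. Piccirillo, J. Lond. Math. Soc. (2) 108 (2023), §3.2, proof of Lemma 3.3. [ManolescuPiccirillo2023]
* A. Hatcher, *Algebraic Topology* (2002), Thm. 1.20, Lemma 1.19, Prop. 1.5. [HatcherAT2002]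
-/

-- the prescribed namespace `Summit.<P>.<Sub>.…` duplicates `SmoothPoincare4` (P = Sub)
set_option linter.dupNamespace false
set_option linter.style.longLine false

noncomputable section

open scoped Manifold ContDiff Topology Real
open Function Set Metric unitInterval
open Literature.Topology.FourManifolds Literature.Topology.FourManifolds.MMSW
open Literature.AlgebraicTopology.FundamentalGroup.PuncturedPlane Literature.Topology.FourManifolds.PlaneComplex
open Literature.Topology.FourManifolds.ConicalDiscTube (kap kapInv norm_kap_lt kap_ne_zero continuous_kap kap_kapInv
  kapInv_kap kapInv_ne_zero kap_third_smul one_third_pos)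

namespace Summit.SmoothPoincare4.SmoothPoincare4.Theorems.DcrGap.MkFriends

namespace FriendsPi1G2

/-! ## A map homotopic to a constant kills every loop -/

/-- **A map homotopic to a constant map kills every loop**: if `f ≃ const z₀` then `f ∘ ℓ` is
null-homotopic rel end points for every loop `ℓ` (the track formula, Hatcher Lemma 1.19:
`[f ∘ ℓ] · [τ] = [τ] · [const ∘ ℓ] = [τ]` for the track `τ` of the base point). [cite: HatcherAT2002, Lemma 1.19] -/
theorem homotopic_refl_map_of_homotopic_const {X Z : Type*} [TopologicalSpace X] [TopologicalSpace Z]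
    {f : C(X, Z)} {z₀ : Z} (hf : f.Homotopic (ContinuousMap.const X z₀)) {x : X} (ℓ : Path x x) :
    (ℓ.map (map_continuous f)).Homotopic (Path.refl (f x)) := by
  obtain ⟨F⟩ := hf
  have h := Path.Homotopic.map_trans_evalAt F ℓ
  have e2 : ℓ.map (map_continuous (ContinuousMap.const X z₀)) = Path.refl _ := by
    ext t
    rfl
  rw [e2] at h
  rw [← Path.Homotopic.Quotient.eq, Path.Homotopic.Quotient.mk_trans, Path.Homotopic.Quotient.mk_trans,
    Path.Homotopic.Quotient.mk_refl, Path.Homotopic.Quotient.trans_refl] at h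
  rw [← Path.Homotopic.Quotient.eq, Path.Homotopic.Quotient.mk_refl]
  calc Path.Homotopic.Quotient.mk (ℓ.map (map_continuous f))
      = ((Path.Homotopic.Quotient.mk (ℓ.map (map_continuous f))).trans
          (Path.Homotopic.Quotient.mk (F.evalAt x))).trans (Path.Homotopic.Quotient.mk (F.evalAt x)).symm := by
        rw [Path.Homotopic.Quotient.trans_assoc, Path.Homotopic.Quotient.trans_symm,
          Path.Homotopic.Quotient.trans_refl]
    _ = (Path.Homotopic.Quotient.mk (F.evalAt x)).trans (Path.Homotopic.Quotient.mk (F.evalAt x)).symm := by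
        rw [h]
    _ = Path.Homotopic.Quotient.refl _ := Path.Homotopic.Quotient.trans_symm _

/-! ## Loops inside the tube are powers of the meridian -/

/-- **Loops inside the tube are powers of the meridian.**  Let `V` be a space over `ℝ⁴` with injective
continuous coordinate map `val` (the exterior `E`, or a copy of it), `T` the tube (smooth, injective,
immersive on `dom = D̊² × B(0,2)`), `Φ : D̊² × (ℂ ∖ 0) → V` the tube map over it,
`val (Φ (x, ζ)) = T(x, κ ζ)` (`κ` the radial squeeze of the plane onto `B(0,2)`), and suppose the points
of `V` in the tube are off the zero section.  Then a loop `δ` of `V` at the base point of the meridian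
`mer = Φ ∘ (slice winding loop of radius 1/3 over x₀)` which stays in `T(dom)` is, in `π₁(V)`, a power of
the meridian: pulled back through `T` (continuous inverse, `continuousOn_invFunOn`) it is the image
under `Φ` of a loop of `D̊² × (ℂ ∖ 0)`, and `π₁` of that is generated by the slice winding loop
(`PuncturedPlane.fromPath_mem_zpowers_slice`, the covering `exp`). [folklore] -/
-- adapted from SliceDiscExteriorMeridian.lean (`ConicalDiscTube.fromPath_mem_zpowers_meridianU`)
theorem fromPath_mem_zpowers_of_tube {V : Type*} [TopologicalSpace V] (val : C(V, EuclideanSpace ℝ (Fin 4))) (hval : Injective val)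
    {T : EuclideanSpace ℝ (Fin 2) × EuclideanSpace ℝ (Fin 2) → EuclideanSpace ℝ (Fin 4)} (hTd : ContDiffOn ℝ ∞ T (ball (0 : EuclideanSpace ℝ (Fin 2)) 1 ×ˢ ball (0 : EuclideanSpace ℝ (Fin 2)) 2)) (hTi : InjOn T (ball (0 : EuclideanSpace ℝ (Fin 2)) 1 ×ˢ ball (0 : EuclideanSpace ℝ (Fin 2)) 2))
    (hTf : ∀ q ∈ (ball (0 : EuclideanSpace ℝ (Fin 2)) 1 ×ˢ ball (0 : EuclideanSpace ℝ (Fin 2)) 2), Injective (fderiv ℝ T q))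
    (Φ : C(↥(ball (0 : EuclideanSpace ℝ (Fin 2)) 1) × CStar, V)) (hΦ : ∀ a, val (Φ a) = T ((a.1 : EuclideanSpace ℝ (Fin 2)), kap (ofC (a.2 : ℂ))))
    (hV : ∀ (v : V), ∀ q ∈ ((ball (0 : EuclideanSpace ℝ (Fin 2)) 1 ×ˢ ball (0 : EuclideanSpace ℝ (Fin 2)) 2) : Set (EuclideanSpace ℝ (Fin 2) × EuclideanSpace ℝ (Fin 2))), val v = T q → q.2 ≠ 0)
    {x₀ : EuclideanSpace ℝ (Fin 2)} (hx₀ : ‖x₀‖ < 1) {b : V} (mer : Path b b)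
    (hmer : ∀ t, mer t = Φ (sliceWindingLoop (⟨x₀, mem_ball_zero_iff.2 hx₀⟩ : ↥(ball (0 : EuclideanSpace ℝ (Fin 2)) 1)) (1 / 3) one_third_pos t))
    (δ : Path b b) (hδ : ∀ t, val (δ t) ∈ T '' (ball (0 : EuclideanSpace ℝ (Fin 2)) 1 ×ˢ ball (0 : EuclideanSpace ℝ (Fin 2)) 2)) :
    FundamentalGroup.fromPath (Path.Homotopic.Quotient.mk δ) ∈
      Subgroup.zpowers (FundamentalGroup.fromPath (Path.Homotopic.Quotient.mk mer)) := by
  haveI : SimplyConnectedSpace ↥(ball (0 : EuclideanSpace ℝ (Fin 2)) 1) := by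
    haveI := (convex_ball (0 : EuclideanSpace ℝ (Fin 2)) 1).contractibleSpace ⟨0, by simp⟩
    infer_instance
  -- the base point in tube coordinates
  set a₀ : ↥(ball (0 : EuclideanSpace ℝ (Fin 2)) 1) × CStar := (⟨x₀, mem_ball_zero_iff.2 hx₀⟩, bpt (1 / 3) one_third_pos) with ha₀
  have hb : Φ a₀ = b := by
    have h := hmer 0
    rw [mer.source, (sliceWindingLoop _ (1 / 3) one_third_pos).source] at h
    exact h.symm
  have hval_b : val b = T (x₀, kap (ofC ((1 / 3 : ℝ) : ℂ))) := by
    rw [← hb, hΦ]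
    rfl
  -- the loop read in `ℝ⁴` and in tube coordinates
  set z : I → EuclideanSpace ℝ (Fin 4) := fun t ↦ val (δ t) with hzdef
  have hz : Continuous z := val.continuous.comp δ.continuous
  have hzN : ∀ t, z t ∈ T '' (ball (0 : EuclideanSpace ℝ (Fin 2)) 1 ×ˢ ball (0 : EuclideanSpace ℝ (Fin 2)) 2) := hδ
  set q : I → EuclideanSpace ℝ (Fin 2) × EuclideanSpace ℝ (Fin 2) := fun t ↦ invFunOn T (ball (0 : EuclideanSpace ℝ (Fin 2)) 1 ×ˢ ball (0 : EuclideanSpace ℝ (Fin 2)) 2) (z t) with hqdef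
  have hq : Continuous q := (continuousOn_invFunOn hTd hTi hTf).comp_continuous hz hzN
  have hqdom : ∀ t, q t ∈ ((ball (0 : EuclideanSpace ℝ (Fin 2)) 1 ×ˢ ball (0 : EuclideanSpace ℝ (Fin 2)) 2) : Set (EuclideanSpace ℝ (Fin 2) × EuclideanSpace ℝ (Fin 2))) := fun t ↦ invFunOn_mem (hzN t)
  have hTq : ∀ t, T (q t) = z t := fun t ↦ invFunOn_eq (hzN t)
  have hq1 : ∀ t, ‖(q t).1‖ < 1 := fun t ↦ mem_ball_zero_iff.1 (hqdom t).1
  have hq2 : ∀ t, ‖(q t).2‖ < 2 := fun t ↦ mem_ball_zero_iff.1 (hqdom t).2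
  have hq0 : ∀ t, (q t).2 ≠ 0 := fun t ↦ hV (δ t) (q t) (hqdom t) (hTq t).symm
  -- end points
  have hends : ∀ t, z t = val b → q t = (x₀, kap (ofC ((1 / 3 : ℝ) : ℂ))) := by
    intro t ht
    change invFunOn T (ball (0 : EuclideanSpace ℝ (Fin 2)) 1 ×ˢ ball (0 : EuclideanSpace ℝ (Fin 2)) 2) (z t) = _
    rw [ht, hval_b]
    exact hTi.leftInvOn_invFunOn ⟨mem_ball_zero_iff.2 hx₀, mem_ball_zero_iff.2 (norm_kap_lt _)⟩
  have hz0 : z 0 = val b := by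
    change val (δ 0) = _
    rw [δ.source]
  have hz1 : z 1 = val b := by
    change val (δ 1) = _
    rw [δ.target]
  have hfib : toC (kapInv (kap (ofC ((1 / 3 : ℝ) : ℂ)))) = ((1 / 3 : ℝ) : ℂ) := by
    rw [kapInv_kap, toC_ofC]
  -- the loop in `D̊² × (ℂ ∖ 0)`
  let β : Path a₀ a₀ :=
    { toFun := fun t ↦ (⟨(q t).1, mem_ball_zero_iff.2 (hq1 t)⟩,
        ⟨toC (kapInv (q t).2), toC_ne_zero (kapInv_ne_zero (hq2 t) (hq0 t))⟩)
      continuous_toFun := by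
        refine ((continuous_fst.comp hq).subtype_mk _).prodMk (Continuous.subtype_mk ?_ _)
        exact continuous_toC.comp (ConicalDiscTube.continuousOn_kapInv.comp_continuous (continuous_snd.comp hq)
          fun t ↦ mem_ball_zero_iff.2 (hq2 t))
      source' := by
        refine Prod.ext (Subtype.ext ?_) (Subtype.ext ?_)
        · change (q 0).1 = x₀
          rw [hends 0 hz0]
        · change toC (kapInv (q 0).2) = ((1 / 3 : ℝ) : ℂ)
          rw [hends 0 hz0]
          exact hfib
      target' := by
        refine Prod.ext (Subtype.ext ?_) (Subtype.ext ?_)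
        · change (q 1).1 = x₀
          rw [hends 1 hz1]
        · change toC (kapInv (q 1).2) = ((1 / 3 : ℝ) : ℂ)
          rw [hends 1 hz1]
          exact hfib }
  have hδβ : ∀ t, δ t = Φ (β t) := fun t ↦ by
    apply hval
    rw [hΦ]
    change z t = T ((q t).1, kap (ofC (toC (kapInv (q t).2))))
    rw [ofC_toC, kap_kapInv (hq2 t), Prod.mk.eta, hTq]
  have e1 := FundamentalGroup.mapOfEq_fromPath_eq Φ hb β δ hδβ
  have e2 := FundamentalGroup.mapOfEq_fromPath_eq Φ hb
    (sliceWindingLoop (⟨x₀, mem_ball_zero_iff.2 hx₀⟩ : ↥(ball (0 : EuclideanSpace ℝ (Fin 2)) 1)) (1 / 3) one_third_pos) mer hmer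
  obtain ⟨n, hn⟩ := Subgroup.mem_zpowers_iff.1
    (fromPath_mem_zpowers_slice (⟨x₀, mem_ball_zero_iff.2 hx₀⟩ : ↥(ball (0 : EuclideanSpace ℝ (Fin 2)) 1)) (1 / 3) one_third_pos β)
  rw [← e1, ← hn, map_zpow, e2]
  exact Subgroup.zpow_mem _ (Subgroup.mem_zpowers _) n

end FriendsPi1G2

open FriendsPi1G2 in
/-- **Kervaire's lemma for the model disc exterior with a trivialised tube** (helper `helper_friendsPi1_G2`,
sub-goal G2 of stub `stub_friendsPi1`).  For the model dotted handlebody `D_k`, a model slice disc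
`Δ₁ = f₁(𝔻²)` of a model knot `K₁ ⊂ ∂D_k` with a trivialised tube `T` of its interior off `D_k`
(`C^∞`, injective, immersive on `D̊² × B(0,2)`, `T(x,0) = f₁ x`), assuming `ℝ⁴ ∖ D_k` simply connected:
if a continuous map `ψ` on the exterior `E = ℝ⁴ ∖ (D_k ∪ Δ₁)` sends the tube meridian
`μ(v) = T(0, v/2)` to a freely null-homotopic loop, then `ψ ∘ γ` is null-homotopic for every loop `γ`
of `E` — `π₁(E)` is normally generated by the meridian.  Proof: Seifert–van Kampen in kernel form
(`VanKampen.fromPath_mem_of_homotopic_refl`) in the simply connected `{x // x ∉ D_k} = U ∪ T(dom)`,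
`U = E`, with `N = ker ψ_*`; loops of `U` in the tube are powers of the meridian
(`fromPath_mem_zpowers_of_tube`), which `ψ` kills (`homotopic_refl_map_of_homotopic_const`); then change
of base point. [cite: KervaireBSMF1965, Ch. I Lemme 1.2] [cite: ManolescuPiccirillo2023, §3.2, proof of Lemma 3.3] [cite: HatcherAT2002, Thm. 1.20] -/
theorem helper_friendsPi1_G2 : ∀ (k : ℕ) (K₁ : (Metric.sphere (0 : EuclideanSpace ℝ (Fin 2)) 1) → EuclideanSpace ℝ (Fin 4)) (f₁ : EuclideanSpace ℝ (Fin 2) → EuclideanSpace ℝ (Fin 4)) (T : EuclideanSpace ℝ (Fin 2) × EuclideanSpace ℝ (Fin 2) → EuclideanSpace ℝ (Fin 4)), Literature.Topology.FourManifolds.MMSW.IsModelKnot k K₁ → Literature.Topology.FourManifolds.MMSW.IsModelSliceDisc k K₁ f₁ → (ContDiffOn ℝ ((⊤ : ℕ∞) : WithTop ℕ∞) T (Metric.ball (0 : EuclideanSpace ℝ (Fin 2)) 1 ×ˢ Metric.ball (0 : EuclideanSpace ℝ (Fin 2)) 2) ∧ Set.InjOn T (Metric.ball (0 : EuclideanSpace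 ℝ (Fin 2)) 1 ×ˢ Metric.ball (0 : EuclideanSpace ℝ (Fin 2)) 2) ∧ (∀ q ∈ Metric.ball (0 : EuclideanSpace ℝ (Fin 2)) 1 ×ˢ Metric.ball (0 : EuclideanSpace ℝ (Fin 2)) 2, Function.Injective (fderiv ℝ T q)) ∧ (∀ q ∈ Metric.ball (0 : EuclideanSpace ℝ (Fin 2)) 1 ×ˢ Metric.ball (0 : EuclideanSpace ℝ (Fin 2)) 2, T q ∉ Literature.Topology.FourManifolds.MMSW.modelHandlebody k) ∧ (∀ x ∈ Metric.ball (0 : EuclideanSpace ℝ (Fin 2)) 1, T (x, 0) = f₁ x)) → SimplyConnectedSpace {x : EuclideanSpace ℝ (Fin 4) // x ∉ Literature.Topology.FourManifolds.MMSW.modelHandlebody k} → ∀ (E : TopologicalSpace.Opens (EuclideanSpace ℝ (Fin 4))), ((E : Set (EuclideanSpace ℝ (Fin 4))) = {x | x ∉ Literature.Topology.FourManifolds.MMSW.modelHandlebody k ∧ x ∉ f₁ '' Metric.closedBall (0 : EuclideanSpace ℝ (Fin 2)) 1}) → ∀ (Z : Type) [TopologicalSpace Z] (ψ : C(E, Z))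 (μ : C((Metric.sphere (0 : EuclideanSpace ℝ (Fin 2)) 1), E)), (∀ v : (Metric.sphere (0 : EuclideanSpace ℝ (Fin 2)) 1), ((μ v : E) : EuclideanSpace ℝ (Fin 4)) = T ((0 : EuclideanSpace ℝ (Fin 2)), (1 / 2 : ℝ) • (v : EuclideanSpace ℝ (Fin 2)))) → (∃ z₀ : Z, (ψ.comp μ).Homotopic (ContinuousMap.const (Metric.sphere (0 : EuclideanSpace ℝ (Fin 2)) 1) z₀)) → ∀ (a : E) (γ : Path a a), (γ.map ψ.continuous).Homotopic (Path.refl (ψ a)) := by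
  intro k K₁ f₁ T hK hf hT hsc E hE Z _ ψ μ hμ hkill a γ
  obtain ⟨hTd, hTi, hTf, hTD, hT0⟩ := hT
  have hEmem : ∀ x : EuclideanSpace ℝ (Fin 4), x ∈ (E : Set (EuclideanSpace ℝ (Fin 4))) ↔ x ∉ modelHandlebody k ∧ x ∉ f₁ '' closedBall (0 : EuclideanSpace ℝ (Fin 2)) 1 :=
    fun x ↦ by rw [hE]; rfl
  -- the ambient space `Y = ℝ⁴ ∖ D_k` and the two pieces of the cover
  set U : Set {x : EuclideanSpace ℝ (Fin 4) // x ∉ modelHandlebody k} := {y | (y : EuclideanSpace ℝ (Fin 4)) ∈ (E : Set (EuclideanSpace ℝ (Fin 4)))} with hUdef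
  set Tt : Set {x : EuclideanSpace ℝ (Fin 4) // x ∉ modelHandlebody k} := {y | (y : EuclideanSpace ℝ (Fin 4)) ∈ T '' (ball (0 : EuclideanSpace ℝ (Fin 2)) 1 ×ˢ ball (0 : EuclideanSpace ℝ (Fin 2)) 2)} with hTtdef
  have hUo : IsOpen U := E.isOpen.preimage continuous_subtype_val
  have hTo : IsOpen Tt := (isOpen_image_dom hTd hTf).preimage continuous_subtype_val
  have hcover : U ∪ Tt = univ := by
    refine eq_univ_of_forall fun y ↦ ?_
    rcases mem_exterior_or_mem_image hK hf hT0 y.2 with h | h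
    · exact Or.inl ((hEmem _).2 h)
    · exact Or.inr h
  have hvalU : Subtype.val '' U = (E : Set (EuclideanSpace ℝ (Fin 4))) := by
    ext z
    constructor
    · rintro ⟨y, hy, rfl⟩
      exact hy
    · intro hz
      exact ⟨⟨z, ((hEmem z).1 hz).1⟩, hz, rfl⟩
  have hvalUT : Subtype.val '' (U ∩ Tt) = T '' (ball (0 : EuclideanSpace ℝ (Fin 2)) 1 ×ˢ ball (0 : EuclideanSpace ℝ (Fin 2)) 2) ∩ {x : EuclideanSpace ℝ (Fin 4) | x ∉ modelHandlebody k ∧ x ∉ f₁ '' closedBall (0 : EuclideanSpace ℝ (Fin 2)) 1} := by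
    ext z
    constructor
    · rintro ⟨y, ⟨hyU, hyT⟩, rfl⟩
      exact ⟨hyT, (hEmem _).1 hyU⟩
    · rintro ⟨hzT, hzE⟩
      exact ⟨⟨z, hzE.1⟩, ⟨(hEmem z).2 hzE, hzT⟩, rfl⟩
  have hUpc : IsPathConnected U := by
    rw [Topology.IsEmbedding.subtypeVal.isInducing.isPathConnected_iff, hvalU, hE]
    exact isPathConnected_exterior hK hf hsc
  have hUTpc : IsPathConnected (U ∩ Tt) := by
    rw [Topology.IsEmbedding.subtypeVal.isInducing.isPathConnected_iff, hvalUT]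
    exact isPathConnected_image_inter_exterior hK hf hTd hTi hTD hT0
  haveI : PathConnectedSpace ↥U := isPathConnected_iff_pathConnectedSpace.1 hUpc
  -- `U` is a copy of `E`
  let toE : C(↥U, ↥E) := ⟨fun u ↦ ⟨((u : {x : EuclideanSpace ℝ (Fin 4) // x ∉ modelHandlebody k}) : EuclideanSpace ℝ (Fin 4)), u.2⟩,
    (continuous_subtype_val.comp continuous_subtype_val).subtype_mk _⟩
  let ofE : C(↥E, ↥U) := ⟨fun v ↦ ⟨⟨(v : EuclideanSpace ℝ (Fin 4)), ((hEmem v).1 v.2).1⟩, v.2⟩,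
    (continuous_subtype_val.subtype_mk _).subtype_mk _⟩
  let valU : C(↥U, EuclideanSpace ℝ (Fin 4)) := ⟨fun u ↦ ((u : {x : EuclideanSpace ℝ (Fin 4) // x ∉ modelHandlebody k}) : EuclideanSpace ℝ (Fin 4)),
    continuous_subtype_val.comp continuous_subtype_val⟩
  have hvalU_inj : Injective valU := fun u u' h ↦ Subtype.ext (Subtype.ext h)
  let ψ' : C(↥U, Z) := ψ.comp toE
  -- the tube map and the meridian
  have hadom : ∀ a : ↥(ball (0 : EuclideanSpace ℝ (Fin 2)) 1) × CStar, ((a.1 : EuclideanSpace ℝ (Fin 2)), kap (ofC (a.2 : ℂ))) ∈ ((ball (0 : EuclideanSpace ℝ (Fin 2)) 1 ×ˢ ball (0 : EuclideanSpace ℝ (Fin 2)) 2) : Set (EuclideanSpace ℝ (Fin 2) × EuclideanSpace ℝ (Fin 2))) :=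
    fun a ↦ ⟨a.1.2, mem_ball_zero_iff.2 (norm_kap_lt _)⟩
  have hΦE : ∀ a : ↥(ball (0 : EuclideanSpace ℝ (Fin 2)) 1) × CStar, T ((a.1 : EuclideanSpace ℝ (Fin 2)), kap (ofC (a.2 : ℂ))) ∈ (E : Set (EuclideanSpace ℝ (Fin 4))) :=
    fun a ↦ (hEmem _).2 ((apply_mem_exterior_iff hK hf hTi hTD hT0 (hadom a)).2 (kap_ne_zero (ofC_ne_zero a.2.2)))
  let Φ : C(↥(ball (0 : EuclideanSpace ℝ (Fin 2)) 1) × CStar, ↥U) :=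
    ⟨fun a ↦ ⟨⟨T ((a.1 : EuclideanSpace ℝ (Fin 2)), kap (ofC (a.2 : ℂ))), hTD _ (hadom a)⟩, hΦE a⟩, by
      refine Continuous.subtype_mk (Continuous.subtype_mk ?_ _) _
      exact hTd.continuousOn.comp_continuous
        ((continuous_subtype_val.comp continuous_fst).prodMk
          (continuous_kap.comp (continuous_ofC.comp (continuous_subtype_val.comp continuous_snd)))) hadom⟩
  have hΦ : ∀ a, valU (Φ a) = T ((a.1 : EuclideanSpace ℝ (Fin 2)), kap (ofC (a.2 : ℂ))) := fun a ↦ rfl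
  have hV : ∀ (v : ↥U), ∀ q ∈ ((ball (0 : EuclideanSpace ℝ (Fin 2)) 1 ×ˢ ball (0 : EuclideanSpace ℝ (Fin 2)) 2) : Set (EuclideanSpace ℝ (Fin 2) × EuclideanSpace ℝ (Fin 2))), valU v = T q → q.2 ≠ 0 := by
    intro v q hq hvq
    have hvE : T q ∈ (E : Set (EuclideanSpace ℝ (Fin 4))) := hvq ▸ v.2
    exact (apply_mem_exterior_iff hK hf hTi hTD hT0 hq).1 ((hEmem _).1 hvE)
  let b : ↥U := ofE (μ (circlePoint 0))
  let ℓ : Path (circlePoint 0 : (Metric.sphere (0 : EuclideanSpace ℝ (Fin 2)) 1)) (circlePoint 0) :=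
    { toFun := fun t ↦ circlePoint (2 * π * t)
      continuous_toFun := continuous_circlePoint.comp (by fun_prop)
      source' := by simp
      target' := by rw [Set.Icc.coe_one, mul_one, ← zero_add (2 * π), circlePoint_add_two_pi] }
  let mer : Path b b := ℓ.map (ofE.comp μ).continuous
  have hmer : ∀ t, mer t = Φ (sliceWindingLoop (⟨0, by simp⟩ : ↥(ball (0 : EuclideanSpace ℝ (Fin 2)) 1)) (1 / 3) one_third_pos t) := by
    intro t
    apply hvalU_inj
    change ((μ (ℓ t) : ↥E) : EuclideanSpace ℝ (Fin 4)) = T ((0 : EuclideanSpace ℝ (Fin 2)), kap (ofC ((windingLoop (1 / 3) one_third_pos 1 t : CStar) : ℂ)))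
    rw [hμ, windingLoop_apply_coe, ofC_polar, kap_third_smul (norm_eq_of_mem_sphere _)]
    change T (0, (1 / 2 : ℝ) • ((circlePoint (2 * π * t) : (Metric.sphere (0 : EuclideanSpace ℝ (Fin 2)) 1)) : EuclideanSpace ℝ (Fin 2))) = _
    simp only [Int.cast_one, mul_one]
  -- `ψ` kills the meridian
  have hmer0 : (mer.map ψ'.continuous).Homotopic (Path.refl _) := by
    obtain ⟨z₀, hz₀⟩ := hkill
    have h := homotopic_refl_map_of_homotopic_const hz₀ ℓ
    have e : ℓ.map (map_continuous (ψ.comp μ)) = mer.map ψ'.continuous := by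
      ext t
      rfl
    rw [e] at h
    exact h
  -- `N = ker ψ'_*` contains the meridian, hence all loops of `U` inside the tube
  have h0 : ψ' b = ψ' b := rfl
  let N : Subgroup (FundamentalGroup (↥U) b) := (FundamentalGroup.mapOfEq ψ' h0).ker
  have key : ∀ δ : Path b b,
      FundamentalGroup.fromPath (Path.Homotopic.Quotient.mk δ) ∈ N ↔ (δ.map ψ'.continuous).Homotopic (Path.refl _) := by
    intro δ
    rw [MonoidHom.mem_ker, FundamentalGroup.mapOfEq_fromPath_eq ψ' h0 δ (δ.map ψ'.continuous) (fun t ↦ rfl),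
      FundamentalGroup.one_def]
    exact Path.Homotopic.Quotient.eq
  have hm : FundamentalGroup.fromPath (Path.Homotopic.Quotient.mk mer) ∈ N := (key _).2 hmer0
  have hN : ∀ δ : Path b b, (∀ t, ((δ t : ↥U) : {x : EuclideanSpace ℝ (Fin 4) // x ∉ modelHandlebody k}) ∈ Tt) →
      FundamentalGroup.fromPath (Path.Homotopic.Quotient.mk δ) ∈ N :=
    fun δ hδ ↦ (Subgroup.zpowers_le.2 hm)
      (fromPath_mem_zpowers_of_tube valU hvalU_inj hTd hTi hTf Φ hΦ hV (by simp) mer hmer δ hδ)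
  -- van Kampen for the loop `α · γ · α⁻¹` at `b`, then change of base point
  have hbT : ((b : ↥U) : {x : EuclideanSpace ℝ (Fin 4) // x ∉ modelHandlebody k}) ∈ Tt := by
    change ((μ (circlePoint 0) : ↥E) : EuclideanSpace ℝ (Fin 4)) ∈ T '' (ball (0 : EuclideanSpace ℝ (Fin 2)) 1 ×ˢ ball (0 : EuclideanSpace ℝ (Fin 2)) 2)
    rw [hμ]
    refine ⟨_, ⟨by simp, mem_ball_zero_iff.2 ?_⟩, rfl⟩
    rw [norm_smul, norm_eq_of_mem_sphere, Real.norm_of_nonneg (by norm_num)]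
    norm_num
  let α : Path b (ofE a) := PathConnectedSpace.somePath _ _
  let γ' : Path (ofE a) (ofE a) := γ.map ofE.continuous
  have hnull : ((((α.trans γ').trans α.symm)).map continuous_subtype_val).Homotopic (Path.refl _) :=
    SimplyConnectedSpace.paths_homotopic _ _
  have h1 := Literature.AlgebraicTopology.FundamentalGroup.VanKampen.fromPath_mem_of_homotopic_refl
    hUo hTo hcover hUpc hUTpc b.2 hbT N hN ((α.trans γ').trans α.symm) hnull
  have h2 := (key _).1 h1
  rw [Path.map_trans, Path.map_trans, ← Path.map_symm] at h2
  have h3 := Path.Homotopic.refl_of_conj (α.map ψ'.continuous) h2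
  have e : γ'.map ψ'.continuous = γ.map ψ.continuous := by
    ext t
    rfl
  rwa [e] at h3

end Summit.SmoothPoincare4.SmoothPoincare4.Theorems.DcrGap.MkFriends

end
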